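import Summits.AtomisticToContinuum.Crystallization.Theorems.ChartedZeroExcessLayeredLatticeLiouvilleUB

/-!
# Zero-excess layered lattice Liouville — part UC (lens-2 g43, node «TameHotDichotomy» beneath [C] `RigidCaccioppoliPG`):
# the SPECIAL/GENERIC cut of the hot-spot question — `[C] ⟸ [T] TameWindowPG ϑ ∧ [C_T] TameRigidCaccioppoliPG ϑ` (PROVED) —
# and the mechanism layer beneath the tame side — `[C_T] ⟸ [KS] KornSobolevPoincareP ∧ [CC] TameGscCaccioppoliPG ϑ` (PROVED)

Line `_16XH19(_tol)` of statement 26636, (M)-side: (R_W) `WildFractionPG` ⟸ (K) ∧ (M) ⟸ FJM-leaf ∧ Gehring-leaf ∧ [C] (parts TR, TY, UA, UB;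
every seam proved).  [C] `RigidCaccioppoliPG` (part UA) is the residual: a weak reverse Hölder inequality for the rigid misfit `σ` of a
re-registration above the background `η`.  Its one open scenario (UA docstring, census M18/M22) is the HOT SPOT: a θ-good, single-site-Nash,
e⋆-GSC-compatible site whose `4`-star is `O(1)`-far from every rotated chart star.  This file separates that scenario from the regularity
mechanism by the lens's structural dichotomy, at the level of CONFIGURATIONS (not balls — the re-registration `Ψ'` is shared):

* SPECIAL = TAME windows: every site of the big window `win 9R` has a `4`-star within `ϑ` of a rotated sub-star of the chart lattice
  (`IsTameStar ϑ`, an `S`-intrinsic, registration-free, tilt-blind criterion).  On tame windows [C] is the perturbative regularity statement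
  [C_T] `TameRigidCaccioppoliPG ϑ` ([C] with the tameness hypothesis added; WEAKER than [C], `tameRigidCaccioppoliPG_of_rigidCaccioppoliPG`).
* GENERIC = windows with a HOT star: excluded outright by [T] `TameWindowPG ϑ` («near-flat fat GSC door windows have no `ϑ`-hot star»), the
  hot-spot existence question in its sharpest, census-decidable form (instrument (F0) of NODE-g43: the maximal rigid star misfit per window).
* Exhaustion is `em` on tameness; the seam `[T] ∧ [C_T] ⇒ [C]` is `rigidCaccioppoliPG_of_tame` (PROVED, thresholds `min/max`).

Beneath the tame side the Giaquinta–Modica mechanism is typed as two pieces with a PROVED algebraic seam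
(`tameRigidCaccioppoliPG_of_gscCaccioppoli_of_kornSobolev`, constant `b = (9/4)·c₁·C_KS + 324·C_KS/κ`, radii `r < 3r/2 < 2r`, NEAR/FAR case split):
* [KS] `KornSobolevPoincareP` — ENERGY-FREE discrete Korn–Sobolev–Poincaré inequality modulo rigid motions on clean door sets
  (FJM in `L^{6/5}` + Sobolev–Poincaré `6/5 → 2` in 3D, transferred by interpolation; KNOWN-type, ATTACKABLE);
* [CC] `TameGscCaccioppoliPG ϑ` — the e⋆-GSC CACCIOPPOLI INEQUALITY MODULO NEARBY RIGID MOTIONS with background floor on tame windows, ball by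
  ball (MECHANISM · GSC-priced · UNDECIDED: the one-step grand-canonical comparison with the rigidly re-fitted chart patch, hole-filled; only
  `κ`-NEAR rigid motions are quantified — far ones are settled in the seam by [KS] and `σ ≤ 12`).
No literature claim is made by the four Props; the record literals are `(aHi; Λ, θ, s; ϑ) = (1; 2, 1/16, 1/50; tameRadius)`.
-/

noncomputable section

open scoped BigOperators
open MeasureTheory Set Metric Filter Topology
open Summit.AtomisticToContinuum.Crystallization.Theorems.ChartedPlanarOrderRigidityDoor (E3 atomsIn)
open Summit.AtomisticToContinuum.Crystallization.Theorems.ChartedPlanarOrderDensityDichotomy (μS IsSep nK nK_nonneg)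
open Summit.AtomisticToContinuum.Crystallization.Theorems.ChartedPlanarOrderCleanScaleP (IsCleanP IsDoorSetP)
open Summit.AtomisticToContinuum.Crystallization.Theorems.ChartedPlanarOrderMesoCut (LayeredHom EnvClose)
open Summit.AtomisticToContinuum.Crystallization.Theorems.ChartedPlanarOrderDoorLayered (atomsIn_subset)
open Summit.AtomisticToContinuum.Crystallization.Theorems.ChartedPlanarOrderDoorLayeredOsc (IsTwoShellAffineGood)
open Literature.Analysis.PDE (finavg ZatorskaGoldstein2005_localGehringLemmaCounting)

namespace Summit.AtomisticToContinuum.Crystallization.Theorems.ChartedZeroExcessLayeredLatticeLiouville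

/-! ### YC.1  Intrinsic tameness of a star (the SPECIAL-class criterion of the dichotomy) -/

/-- ★ **`IsTameStar ϑ S H x` — the `4`-star of `S` at `x` is `ϑ`-TAME relative to the model set `H`**: there are a rotation `U` (linear isometry of
determinant `1`) and a map `g` of the star `S ∩ closedBall x 4` into `H` such that every `4`-bond `p − x` (`p ∈ S`, `dist p x ≤ 4`), rotated by `U`,
matches the model bond `g p − g x` within `ϑ`.  `S`-INTRINSIC given `H` (no registration, no window), tilt-BLIND (`U` free), dilation-SENSITIVE
(`U` is an isometry: a locally dilated star is not tame for small `ϑ`).  The content is in SMALL `ϑ`: with `g :=` any tear-free registration and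
`U := 1` every star is `12`-tame (`isTameStar_twelve_of_globalReg`); tilt–strain data `(Q, σ)` of a registration `Ψ : S → H` with `σ x ≤ ϑ`
witness `ϑ`-tameness at `x` (`isTameStar_of_tiltStrainData`).  A star that is NOT `ϑ`-tame is a `ϑ`-HOT star (census instrument (F0)). [this file, g43] -/
def IsTameStar (ϑ : ℝ) (S H : Set E3) (x : E3) : Prop :=
  ∃ (U : E3 ≃ₗᵢ[ℝ] E3) (g : E3 → E3), LinearMap.det (U.toLinearEquiv : E3 →ₗ[ℝ] E3) = 1 ∧
    MapsTo g (S ∩ closedBall x 4) H ∧ ∀ p ∈ S, dist p x ≤ 4 → dist (U (p - x)) (g p - g x) ≤ ϑ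

/-- **`IsTameOn ϑ S H K`** — every site of `K` has a `ϑ`-tame star. [this file, g43] -/
def IsTameOn (ϑ : ℝ) (S H K : Set E3) : Prop := ∀ x ∈ K, IsTameStar ϑ S H x

/-- tameness is monotone in the threshold. [this file, g43] -/
theorem IsTameStar.mono {ϑ ϑ' : ℝ} (h : ϑ ≤ ϑ') {S H : Set E3} {x : E3} (hx : IsTameStar ϑ S H x) : IsTameStar ϑ' S H x := by
  obtain ⟨U, g, hU, hg, hb⟩ := hx
  exact ⟨U, g, hU, hg, fun p hp hpx => (hb p hp hpx).trans h⟩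

/-- tameness of a set is monotone in the threshold and antitone in the set. [this file, g43] -/
theorem IsTameOn.mono {ϑ ϑ' : ℝ} (h : ϑ ≤ ϑ') {S H K K' : Set E3} (hK : K' ⊆ K) (hT : IsTameOn ϑ S H K) : IsTameOn ϑ' S H K' :=
  fun x hx => (hT x (hK hx)).mono h

/-- DICTIONARY: tilt–strain data `(Q, σ)` of a map `Ψ : S → H` on `win R` with `σ x ≤ ϑ` witness the `ϑ`-tameness of the star at `x ∈ win R`
(`U := Q x`, `g := Ψ`). [this file, g43] -/
theorem isTameStar_of_tiltStrainData {S H : Set E3} {R : ℝ} {Ψ : E3 → E3} {Q : E3 → (E3 ≃ₗᵢ[ℝ] E3)} {σ : E3 → ℝ}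
    (hd : IsTiltStrainData S R Ψ Q σ) (hΨ : MapsTo Ψ S H) {x : E3} (hx : x ∈ atomsIn (μS S) 0 R) {ϑ : ℝ} (hσ : σ x ≤ ϑ) :
    IsTameStar ϑ S H x :=
  ⟨Q x, Ψ, hd.1 x, fun _ hp => hΨ hp.1, fun p hp hpx => (hd.2.2 x hx p hp hpx).trans hσ⟩

/-- DICTIONARY (window form): a registration whose strain profile is `≤ ϑ` on `win R` makes `win R` `ϑ`-tame. [this file, g43] -/
theorem isTameOn_of_tiltStrainData {S H : Set E3} {R : ℝ} {Ψ : E3 → E3} {Q : E3 → (E3 ≃ₗᵢ[ℝ] E3)} {σ : E3 → ℝ}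
    (hd : IsTiltStrainData S R Ψ Q σ) (hΨ : MapsTo Ψ S H) {ϑ : ℝ} (hσ : ∀ x ∈ atomsIn (μS S) 0 R, σ x ≤ ϑ) :
    IsTameOn ϑ S H (atomsIn (μS S) 0 R) :=
  fun x hx => isTameStar_of_tiltStrainData hd hΨ hx (hσ x hx)

/-- VACUITY GUARD: under any globally registered `Ψ` every star of `S` is `12`-tame (`U := 1`, `g := Ψ`; tear-free `4 ↦ 8`) — the content of
tameness is in small `ϑ`. [this file, g43] -/
theorem isTameStar_twelve_of_globalReg {Cg η R : ℝ} {S H : Set E3} {Ψ : E3 → E3} (hΨ : IsGlobalReg Cg η R S H Ψ) {x : E3} (hx : x ∈ S) :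
    IsTameStar 12 S H x :=
  ⟨LinearIsometryEquiv.refl ℝ E3, Ψ, det_refl_E3_eq_one, fun _ hp => hΨ.1.mapsTo hp.1,
    fun _ hp hpx => dist_rot_bond_le_twelve hΨ.2.1 _ hx hp hpx⟩

/-! ### YC.2  The dichotomy beneath [C]: [T] (no hot stars) and [C_T] ([C] on tame windows) -/

/-- ★★ **[T] «TameWindowPG ϑ aHi Λ θ s» — NEAR-FLAT FAT GSC DOOR WINDOWS HAVE NO `ϑ`-HOT STAR** (the GENERIC side excluded outright).  With [C]'s
binder prefix minus the constants (`∀ δ a Cg`, `∀ K₀ ∃ η₁ R₁`): for every θ-good GSC door set `S`, level `η ≤ η₁`, radius `R ≥ R₁`, equilibrium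
`s`-chart `(L, w)` and global registration `Ψ` at `(Cg, η, R)` with the window FAT (`K₀ ≤ η·nK(win R)`), EVERY site of `win 9R` is `ϑ`-tame relative
to the chart lattice `LayeredHom L w`.  Pointwise and `S`-intrinsic (no re-registration: the chart lattice only fixes the catalogue of model stars);
incomparable with (R_W)/(M)/[C] (those are mass statements with a free re-registration); for `ϑ ≥ 12` trivial (`isTameStar_twelve_of_globalReg`).
NEW · the hot-spot EXISTENCE question isolated · GSC-priced (door `IsDoorSetPG`) · UNDECIDED(stated test: census instrument (F0) «HotStarScan» — the
maximal Kabsch misfit `m(x)` of a `4`-star to a rotated catalogue star of the chart lattice; (F0a) on the 54 relaxed interior windows of TAG 174 (a⁗)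
the prediction `m < 1/20` is already implied by Table A of I18-W174 (wild mass at radius `1/20` with both bond ends inside the window EXACTLY ZERO under
the κ-optimal chart); (F0b) the informative run is the census's pending (a⁗) follow-up 6 — GENERATED defected-but-θ-good relaxed configurations
(frustrated stacking kinks, coherent twin platelets across a non-layer close-packed plane, coherent micro-nuclei): do they relax to single-site-Nash
states WITH a hot star, and do those pass the finite e⋆-replacement (GSC-proxy) test; kill sign: one such window passing both with `m(x) ≥ ϑ`) ·
INSTRUMENTABLE · IDEA-NAMED (size dichotomy of hot clusters: FAT hot regions of radius `≳ 1/ϑ` are excluded by an e⋆-GSC volume-vs-surface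
comparison with the relaxed chart continuation (Cauchy–Born stability of the equilibrium chart, `UniformTameStability`); SMALL isolated hot clusters
inside a tame collar are a finite-dimensional local-rigidity problem (certified relaxation / interval Newton on the star equations); THIN hot
structures (filaments, sheets) are the open middle).
Why it might fail: a coherent, defect-free, self-equilibrated elastic anomaly (a force-dipole cluster: single-site Nash, two-shell clean, charted)
that no finite grand-canonical replacement at `μ = e⋆` improves — none is known for Lennard-Jones fcc/hcp, none seen in the census, but no theorem
excludes it; and the threshold must sit above the word floor's intrinsic stacking misfits (`ϑ = 1/20 ≫ √ε_w ≈ 10⁻²`).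
Sources: hot-spot scenario of (R_W)/(M)/[C] (parts TB, TR, UA); Ehrlacher–Ortner–Shapeev, Arch. Ration. Mech. Anal. 222 (2016) 1217 (decay/regularity
of lattice equilibria around defects); Theil, Comm. Math. Phys. 262 (2006) 209 and Flatley–Theil, arXiv 1407.0692 (local rigidity of clean cells);
E–Ming, Arch. Ration. Mech. Anal. 183 (2007) 241; census TAG 174 (a⁗), M18/M22. [this file, g43] -/
def TameWindowPG (ϑ aHi Λ θ s : ℝ) : Prop :=
  ∀ δ : ℝ, 0 < δ → ∀ a : ℝ, 0 < a → ∀ Cg : ℝ, 1 ≤ Cg → ∀ K₀ : ℝ, 0 < K₀ → ∃ η₁ : ℝ, 0 < η₁ ∧ ∃ R₁ : ℝ, 0 < R₁ ∧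
    ∀ S : Set E3, IsDoorSetPG aHi δ S → (∀ q ∈ S, IsTwoShellAffineGood θ S q) →
      ∀ η : ℝ, 0 < η → η ≤ η₁ → ∀ R : ℝ, R₁ ≤ R →
        ∀ (L : E3 ≃L[ℝ] E3) (w : ℤ → E3), IsEquilChart a s Λ L w →
          ∀ Ψ : E3 → E3, IsGlobalReg Cg η R S (LayeredHom (L : E3 →L[ℝ] E3) w) Ψ →
            K₀ ≤ η * nK (atomsIn (μS S) 0 R) →
              IsTameOn ϑ S (LayeredHom (L : E3 →L[ℝ] E3) w) (atomsIn (μS S) 0 (9 * R))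

/-- ★★ **[C_T] «TameRigidCaccioppoliPG ϑ aHi Λ θ s» — [C] ON TAME WINDOWS** (the SPECIAL side): verbatim [C] `RigidCaccioppoliPG` with the extra
hypothesis `IsTameOn ϑ S (LayeredHom L w) (win 9R)` after fatness.  WEAKER than [C] (`tameRigidCaccioppoliPG_of_rigidCaccioppoliPG`, PROVED; strictly
at currency level: a window with one naked `ϑ`-hot star in a strain-free environment violates [C] (ii) on the balls `B(x₀, r)`, `(b/32)^{3/2} ≤ #B ≤
ϑ²/(b·A·η)`, and is not addressed by [C_T]).  This is the perturbative regularity statement: on a tame window every star is `ϑ`-close to a rotated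
chart star, so the site energies admit the second-order expansion about the equilibrium chart that the Caccioppoli comparison needs.
MECHANISM-KNOWN-type (Giaquinta–Modica: [KS] ∧ [CC] below, seam PROVED) · GSC-priced · UNDECIDED · ATTACKABLE·XL through [CC].
Why it might fail: as [CC] — mesoscopically BENT tame balls (rotation drifting by `O(1)` across `B(x, 3r/2)`, `r ≫ 1/ϑ`) defeat the cut-off
competitor unless Chebyshev-bad collar atoms are deleted at `|e⋆|` each (part TC's device), and the hole-filling iteration must terminate at the
lattice collar width; tameness itself does not bound the re-registration's strain below `ϑ`, only the INTRINSIC misfit.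
Sources: [giaquinta1984 Ch. V §2, Ch. IX]; Giusti in [hildebrandt1988 pp. 85–86, (2.1) via the hole-filling Lemma]; parts UA ([C]), TC ((C♭)). [this file, g43] -/
def TameRigidCaccioppoliPG (ϑ aHi Λ θ s : ℝ) : Prop :=
  ∀ δ : ℝ, 0 < δ → ∀ a : ℝ, 0 < a → ∀ Cg : ℝ, 1 ≤ Cg → ∃ Cg' : ℝ, Cg ≤ Cg' ∧
    ∃ b : ℝ, 0 < b ∧ ∃ d : ℝ, 0 < d ∧ d < 1 ∧ ∃ A : ℝ, 0 ≤ A ∧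
    ∀ K₀ : ℝ, 0 < K₀ → ∃ η₁ : ℝ, 0 < η₁ ∧ ∃ R₁ : ℝ, 0 < R₁ ∧
      ∀ S : Set E3, IsDoorSetPG aHi δ S → (∀ q ∈ S, IsTwoShellAffineGood θ S q) →
        ∀ η : ℝ, 0 < η → η ≤ η₁ → ∀ R : ℝ, R₁ ≤ R →
          ∀ (L : E3 ≃L[ℝ] E3) (w : ℤ → E3), IsEquilChart a s Λ L w →
            ∀ Ψ : E3 → E3, IsGlobalReg Cg η R S (LayeredHom (L : E3 →L[ℝ] E3) w) Ψ →
              K₀ ≤ η * nK (atomsIn (μS S) 0 R) →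
                IsTameOn ϑ S (LayeredHom (L : E3 →L[ℝ] E3) w) (atomsIn (μS S) 0 (9 * R)) →
                ∃ Ψ' : E3 → E3, IsGlobalReg Cg' η R S (LayeredHom (L : E3 →L[ℝ] E3) w) Ψ' ∧
                  ∃ (Q : E3 → (E3 ≃ₗᵢ[ℝ] E3)) (σ : E3 → ℝ), IsTiltStrainData S (8 * R) Ψ' Q σ ∧
                    (∑ᶠ x ∈ atomsIn (μS S) 0 (8 * R), σ x ^ 2) ≤ A * η * nK (atomsIn (μS S) 0 (8 * R)) ∧
                    ∀ x ∈ S, ∀ r : ℝ, 0 < r → S ∩ ball x (2 * r) ⊆ ball 0 (8 * R) →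
                      finavg (S ∩ ball x r) (fun y => σ y ^ 2) ≤
                        b * ((finavg (S ∩ ball x (2 * r)) (fun y => (σ y ^ 2) ^ d)) ^ (1 / d) + A * η)

/-- ★★★ **SEAM (PROVED): `[T] ∧ [C_T] ⇒ [C]`** — the dichotomy is exhaustive (a fat near-flat window is tame by [T], then [C_T] applies);
thresholds `η₁ := min`, `R₁ := max`, constants those of [C_T]. [this file, g43] -/
theorem rigidCaccioppoliPG_of_tame {ϑ aHi Λ θ s : ℝ} (hT : TameWindowPG ϑ aHi Λ θ s) (hC : TameRigidCaccioppoliPG ϑ aHi Λ θ s) :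
    RigidCaccioppoliPG aHi Λ θ s := by
  intro δ hδ a ha Cg hCg
  obtain ⟨Cg', hCg', b, hb, d, hd0, hd1, A, hA, hK⟩ := hC δ hδ a ha Cg hCg
  refine ⟨Cg', hCg', b, hb, d, hd0, hd1, A, hA, fun K₀ hK₀ => ?_⟩
  obtain ⟨η₁, hη₁, R₁, hR₁, h1⟩ := hT δ hδ a ha Cg hCg K₀ hK₀
  obtain ⟨η₁', hη₁', R₁', hR₁', h2⟩ := hK K₀ hK₀
  refine ⟨min η₁ η₁', lt_min hη₁ hη₁', max R₁ R₁', lt_max_of_lt_left hR₁, ?_⟩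
  intro S hS hgood η hη hηle R hR L w hLw Ψ hΨ hfat
  exact h2 S hS hgood η hη (hηle.trans (min_le_right _ _)) R ((le_max_right _ _).trans hR) L w hLw Ψ hΨ hfat
    (h1 S hS hgood η hη (hηle.trans (min_le_left _ _)) R ((le_max_left _ _).trans hR) L w hLw Ψ hΨ hfat)

/-- **[C] ⇒ [C_T] (PROVED)** — the tame side is WEAKER than [C] (the tameness hypothesis is simply not used). [this file, g43] -/
theorem tameRigidCaccioppoliPG_of_rigidCaccioppoliPG {ϑ aHi Λ θ s : ℝ} (h : RigidCaccioppoliPG aHi Λ θ s) :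
    TameRigidCaccioppoliPG ϑ aHi Λ θ s := by
  intro δ hδ a ha Cg hCg
  obtain ⟨Cg', hCg', b, hb, d, hd0, hd1, A, hA, hK⟩ := h δ hδ a ha Cg hCg
  refine ⟨Cg', hCg', b, hb, d, hd0, hd1, A, hA, fun K₀ hK₀ => ?_⟩
  obtain ⟨η₁, hη₁, R₁, hR₁, h1⟩ := hK K₀ hK₀
  exact ⟨η₁, hη₁, R₁, hR₁, fun S hS hgood η hη hηle R hR L w hLw Ψ hΨ hfat _ =>
    h1 S hS hgood η hη hηle R hR L w hLw Ψ hΨ hfat⟩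

/-! ### YC.3  The mechanism layer beneath the tame side: [KS] (kinematics, energy-free) and [CC] (the e⋆-GSC comparison) -/

/-- ★★ **[KS] «KornSobolevPoincareP aHi θ» — DISCRETE KORN–SOBOLEV–POINCARÉ INEQUALITY MODULO RIGID MOTIONS ON CLEAN DOOR SETS** (ENERGY-FREE by
type: door `IsDoorSetP`; KNOWN-type).  For every `δ` there are `C_KS ≥ 1` and an exponent `0 < d < 1` such that for every θ-good `aHi`-door set
`S`, every map `Ψ` with tilt–strain data `(Q, σ)` on `win R`, every centre `x ∈ S` and radius `ρ > 0` with `S ∩ ball x (4ρ/3) ⊆ ball 0 R`, there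
is a PROPER RIGID MOTION `p ↦ U p + v` (`det U = 1`) with `⨍_{S ∩ B(x,ρ)} ‖Ψ p − (U p + v)‖² ≤ C_KS·ρ²·(⨍_{S ∩ B(x,4ρ/3)} (σ²)^d)^{1/d}`.
Mechanism (KNOWN-type): `d = 3/5` — the Friesecke–James–Müller estimate in `L^{6/5}` (tree leaf `FrieseckeJamesMuller2002_geometricRigidityLp`,
every `1 < p < ∞`) for the piecewise-affine interpolant of `Ψ` on the θ-good cells (cellwise `dist(∇Ψ̃, SO(3)) ≲ σ`, the K-side transfer of parts
TS–TX at `p = 3`), then the Sobolev–Poincaré inequality `W^{1,6/5} → L²` on the ball (`p* = 2` in 3D); below scale `4` the star at `x` alone gives it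
with `U := Q x` (`C_KS ≥ (12/δ)⁵/δ²`).  TRUE-type expected · ATTACKABLE·L (two citations + interpolation bookkeeping).  The exponent gain `d < 1` is
what feeds the Gehring leaf; plain Poincaré (`d = 1`) would not.
Why it might fail: only through the typing — the margin `4/3` must leave room for the boundary cells of the interpolation (it does for `ρ ≥ ρ₀(δ)`;
smaller balls are covered by the star argument), and sites whose `4`-neighbourhood does not span a frame (excluded: θ-good two-shell stars).
Sources: Friesecke–James–Müller, Comm. Pure Appl. Math. 55 (2002) 1461, Thm 3.1 and §3 (L^p remark); Conti–Schweizer, Comm. Pure Appl. Math. 59 (2006)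
830; Schmidt, Netw. Heterog. Media 4 (2009) 789; Alicandro–Lazzaroni–Palombaro, arXiv 1601.05968 (discrete rigidity beyond nearest neighbours);
[kruzik2019 Thm 1.1.12]; this tree: `Literature.Analysis.PDE.FrieseckeJamesMuller2002_geometricRigidityLp`, parts TS–TY. [this file, g43] -/
def KornSobolevPoincareP (aHi θ : ℝ) : Prop :=
  ∀ δ : ℝ, 0 < δ → ∃ CKS : ℝ, 1 ≤ CKS ∧ ∃ d : ℝ, 0 < d ∧ d < 1 ∧
    ∀ S : Set E3, IsDoorSetP aHi δ S → (∀ q ∈ S, IsTwoShellAffineGood θ S q) →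
      ∀ (R : ℝ) (Ψ : E3 → E3) (Q : E3 → (E3 ≃ₗᵢ[ℝ] E3)) (σ : E3 → ℝ), IsTiltStrainData S R Ψ Q σ →
        ∀ x ∈ S, ∀ ρ : ℝ, 0 < ρ → S ∩ ball x (4 / 3 * ρ) ⊆ ball 0 R →
          ∃ (U : E3 ≃ₗᵢ[ℝ] E3) (v : E3), LinearMap.det (U.toLinearEquiv : E3 →ₗ[ℝ] E3) = 1 ∧
            finavg (S ∩ ball x ρ) (fun p => ‖Ψ p - (U p + v)‖ ^ 2) ≤
              CKS * ρ ^ 2 * (finavg (S ∩ ball x (4 / 3 * ρ)) (fun y => (σ y ^ 2) ^ d)) ^ (1 / d)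

/-- ★★ **[CC] «TameGscCaccioppoliPG ϑ aHi Λ θ s» — THE e⋆-GSC CACCIOPPOLI INEQUALITY MODULO NEARBY RIGID MOTIONS, WITH BACKGROUND FLOOR, ON TAME WINDOWS**
(the residual of the mechanism line; MECHANISM · GSC-priced · UNDECIDED).  With [C_T]'s binders: a re-registration `Ψ'` at `(Cg', η, R)` and tilt–strain
data `(Q, σ)` on `win 8R`, `σ ≤ 12` pointwise (free for tear-free registrations, `dist_rot_bond_le_twelve`), with (i) `Σ_{win 8R} σ² ≤ A·η·nK(win 8R)`
and (ii♭) for every atom-centred ball `B(x, r)` whose double lies in `ball 0 (8R)` and every proper rigid motion `p ↦ U p + v` that is `κ`-NEAR on the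
`3/2`-ball (`⨍_{S ∩ B(x,3r/2)} ‖Ψ' p − (U p + v)‖² ≤ κ·r²`):  `⨍_{S ∩ B(x,r)} σ² ≤ c₁·(⨍_{S ∩ B(x,3r/2)} ‖Ψ' p − (U p + v)‖² / r² + A·η)` — strain energy
on a ball is controlled by the squared distance of the registered positions to a NEARBY RIGIDLY MOVED CHART PATCH on the `3/2`-ball, plus the background.
The NEAR-RIGID RESTRICTION is where the content is: for `κ`-FAR rigid motions the inequality is automatic in the seam (`σ ≤ 12` and [KS] force the
`d`-mean on `B(x,2r)` above `4κ/(9·C_KS)`), so mesoscopically BENT balls (rotation drifting by `≳ √κ` across `B(x,3r/2)`) are OUT OF SCOPE by type and the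
provider may linearise about the single rotation `U` with relative error `O(√κ + ϑ)`, `κ` of its choice.
Mechanism (the one place e⋆-GSC bites in the line): test `IsEStarGSC` on `S ∩ B(x, t)`, `r ≤ s < t ≤ 3r/2`, against the competitor «chart sites
`Ψ' p` moved by `(U, v)⁻¹` inside `B(x, s)`, cut-off interpolation on the collar `B_t ∖ B_s`, `S` outside, Chebyshev-bad collar atoms
(`‖Ψ' p − (U p + v)‖ > c₀(t − s)`) DELETED at price `|e⋆|` each» — same chart word on both sides, so the word excess cancels; the equilibrium chart is
force-free, so the expansion starts at second order and Cauchy–Born/phonon stability of the chart (`UniformTameStability`, X-type cert) bounds the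
interior from below by `c·Σ_{B_s} σ²` up to null-Lagrangian collar fluxes, which single-site force balance (Nash) keeps at `O(η)` per collar site (the
floor); the collar costs `C·(Σ_{B_t∖B_s} σ² + (t−s)⁻²·Σ_{B_t} ‖Ψ' − rigid‖² + #deleted)`.  This is the ANNULAR form; hole filling and the nested-radii
iteration [giaquinta1984 Ch. V Lemma 3.1] give (ii♭) [hildebrandt1988 p. 86 ⇒ (2.1) p. 85].  Ball-level and multi-scale, unlike the window-level
Caccioppoli items (C) `CaccioppoliPGL` (part Q) and (C♭) `PositionCaccioppoliPG` (part TC) of this column, and stated for the rigid misfit `σ` of a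
re-registration rather than for positions.
Why it might fail: (a) the iteration must stop at the lattice collar width (`t − s ≥ 8`), leaving a tail `θ^k·Σ_{B_{3r/2}} σ²`, `θ^k = (16/r)^p` with
`p = log(1/θ)/log(1/τ)` free (constant-costly); absorbing it UNIFORMLY IN `η` is NOT automatic — against the `d`-mean it fails when the `d`-mean on
`B(x,2r)` is below `(32/r)^p`, against the floor when `r ≲ η^{−1/(p(1+d))}` — so the last `O(1)`-width step must come hole-free, from single-site force
balance (Nash = the Euler–Lagrange equations, available on door sets) tested against the cut-off displacement, which works when the rotation field is
slowly varying on `B(x, 3r/2)` — granted IN MEAN SQUARE by the `κ`-near restriction, but a POINTWISE rotated grain inside a near-rigid ball is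
excluded only through tameness + GSC (a grain needs a boundary of hot stars or a strain collar): the delicate point of the piece; (b) Chebyshev-bad
collar atoms (`‖Ψ' p − (U p + v)‖ > c₀(t−s)`) are priced `|e⋆|` each, and `|e⋆|·#bad ≤ C·(t−s)⁻²·Σ‖Ψ' − rigid‖²` is the right-hand side only if `c₀`
is uniform; (c) the hot-spot scenario is EXCLUDED here by hypothesis (tameness), so the remaining risk is the perturbation theory, not existence.
Sources: Giaquinta–Modica, J. reine angew. Math. 311/312 (1979) 145; [giaquinta1984 Ch. V, Ch. IX (Caccioppoli from minimality)]; Giusti in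
[hildebrandt1988 pp. 85–86]; Evans, Arch. Ration. Mech. Anal. 95 (1986) 227; E–Ming 2007; this tree: `IsEStarGSC`, (C) part Q, (C♭) part TC,
`UniformTameStability` (part TP). [this file, g43] -/
def TameGscCaccioppoliPG (ϑ aHi Λ θ s : ℝ) : Prop :=
  ∀ δ : ℝ, 0 < δ → ∀ a : ℝ, 0 < a → ∀ Cg : ℝ, 1 ≤ Cg → ∃ Cg' : ℝ, Cg ≤ Cg' ∧
    ∃ c₁ : ℝ, 0 < c₁ ∧ ∃ κ : ℝ, 0 < κ ∧ ∃ A : ℝ, 0 ≤ A ∧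
    ∀ K₀ : ℝ, 0 < K₀ → ∃ η₁ : ℝ, 0 < η₁ ∧ ∃ R₁ : ℝ, 0 < R₁ ∧
      ∀ S : Set E3, IsDoorSetPG aHi δ S → (∀ q ∈ S, IsTwoShellAffineGood θ S q) →
        ∀ η : ℝ, 0 < η → η ≤ η₁ → ∀ R : ℝ, R₁ ≤ R →
          ∀ (L : E3 ≃L[ℝ] E3) (w : ℤ → E3), IsEquilChart a s Λ L w →
            ∀ Ψ : E3 → E3, IsGlobalReg Cg η R S (LayeredHom (L : E3 →L[ℝ] E3) w) Ψ →
              K₀ ≤ η * nK (atomsIn (μS S) 0 R) →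
                IsTameOn ϑ S (LayeredHom (L : E3 →L[ℝ] E3) w) (atomsIn (μS S) 0 (9 * R)) →
                ∃ Ψ' : E3 → E3, IsGlobalReg Cg' η R S (LayeredHom (L : E3 →L[ℝ] E3) w) Ψ' ∧
                  ∃ (Q : E3 → (E3 ≃ₗᵢ[ℝ] E3)) (σ : E3 → ℝ), IsTiltStrainData S (8 * R) Ψ' Q σ ∧ (∀ x, σ x ≤ 12) ∧
                    (∑ᶠ x ∈ atomsIn (μS S) 0 (8 * R), σ x ^ 2) ≤ A * η * nK (atomsIn (μS S) 0 (8 * R)) ∧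
                    ∀ x ∈ S, ∀ r : ℝ, 0 < r → S ∩ ball x (2 * r) ⊆ ball 0 (8 * R) →
                      ∀ (U : E3 ≃ₗᵢ[ℝ] E3) (v : E3), LinearMap.det (U.toLinearEquiv : E3 →ₗ[ℝ] E3) = 1 →
                        finavg (S ∩ ball x (3 / 2 * r)) (fun p => ‖Ψ' p - (U p + v)‖ ^ 2) ≤ κ * r ^ 2 →
                          finavg (S ∩ ball x r) (fun y => σ y ^ 2) ≤
                            c₁ * (finavg (S ∩ ball x (3 / 2 * r)) (fun p => ‖Ψ' p - (U p + v)‖ ^ 2) / r ^ 2 + A * η)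

/-- the finite average of a family bounded above by a nonnegative constant is bounded by it (junk cases `K` infinite / empty give `0`). [this file, g43] -/
theorem finavg_le_of_le {K : Set E3} {h : E3 → ℝ} {c : ℝ} (hc : 0 ≤ c) (hh : ∀ y ∈ K, h y ≤ c) : finavg K h ≤ c := by
  unfold finavg
  by_cases hK : K.Finite
  · rcases K.eq_empty_or_nonempty with hKe | hne
    · subst hKe
      simp only [finsum_mem_empty, Set.ncard_empty, Nat.cast_zero, div_zero]
      exact hc
    · have hpos : (0 : ℝ) < (K.ncard : ℝ) := by exact_mod_cast (Set.ncard_pos hK).2 hne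
      rw [div_le_iff₀ hpos, finsum_mem_eq_finite_toFinset_sum _ hK, Set.ncard_eq_toFinset_card _ hK]
      calc ∑ y ∈ hK.toFinset, h y ≤ ∑ _y ∈ hK.toFinset, c :=
            Finset.sum_le_sum fun y hy => hh y (hK.mem_toFinset.1 hy)
        _ = c * (hK.toFinset.card : ℝ) := by rw [Finset.sum_const, nsmul_eq_mul, mul_comm]
  · have h0 : (K.ncard : ℝ) = 0 := by exact_mod_cast Set.Infinite.ncard hK
    rw [h0, div_zero]
    exact hc

/-- ★★★ **SEAM (PROVED): `[KS] ∧ [CC] ⇒ [C_T]`** — at the ball `B(x, r)`: [KS] at radius `ρ := 3r/2` (`4/3·ρ = 2r`, data on `win 8R`) produces the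
rigid motion `(U, v)` with `⨍_{B(x,3r/2)} ‖Ψ' − rigid‖² ≤ C_KS·(3r/2)²·M`, `M := (⨍_{B(x,2r)} (σ²)^d)^{1/d}`.  NEAR case (`⨍ ≤ κ r²`): (ii♭) at `(U, v)` gives
[C] (ii) with `(9/4)·c₁·C_KS`; FAR case (`⨍ > κ r²`): `M > 4κ/(9 C_KS)` while `⨍_{B(x,r)} σ² ≤ 144` (`σ ≤ 12`), so [C] (ii) holds with `324·C_KS/κ`.
Constant `b := (9/4)·c₁·C_KS + 324·C_KS/κ`, exponent [KS]'s `d`. [this file, g43] -/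
theorem tameRigidCaccioppoliPG_of_gscCaccioppoli_of_kornSobolev {ϑ aHi Λ θ s : ℝ} (hKS : KornSobolevPoincareP aHi θ)
    (hCC : TameGscCaccioppoliPG ϑ aHi Λ θ s) : TameRigidCaccioppoliPG ϑ aHi Λ θ s := by
  intro δ hδ a ha Cg hCg
  obtain ⟨CKS, hCKS, d, hd0, hd1, hks⟩ := hKS δ hδ
  obtain ⟨Cg', hCg', c₁, hc₁, κ, hκ, A, hA, hK⟩ := hCC δ hδ a ha Cg hCg
  have hCKS0 : 0 < CKS := by linarith
  refine ⟨Cg', hCg', 9 / 4 * c₁ * CKS + 324 * CKS / κ, by positivity, d, hd0, hd1, A, hA, fun K₀ hK₀ => ?_⟩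
  obtain ⟨η₁, hη₁, R₁, hR₁, hmain⟩ := hK K₀ hK₀
  refine ⟨η₁, hη₁, R₁, hR₁, ?_⟩
  intro S hS hgood η hη hηle R hR L w hLw Ψ hΨ hfat htame
  obtain ⟨Ψ', hΨ', Q, σ, hd, h12, hL2, hii⟩ := hmain S hS hgood η hη hηle R hR L w hLw Ψ hΨ hfat htame
  refine ⟨Ψ', hΨ', Q, σ, hd, hL2, ?_⟩
  intro x hx r hr hsub
  have hρ : (0 : ℝ) < 3 / 2 * r := by positivity
  have hball : ball x (4 / 3 * (3 / 2 * r)) = ball x (2 * r) := by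
    congr 1; ring
  have hsub' : S ∩ ball x (4 / 3 * (3 / 2 * r)) ⊆ ball 0 (8 * R) := by rw [hball]; exact hsub
  obtain ⟨U, v, hU, hks'⟩ := hks S hS.isDoorSetP hgood (8 * R) Ψ' Q σ hd x hx (3 / 2 * r) hρ hsub'
  rw [hball] at hks'
  set M : ℝ := (finavg (S ∩ ball x (2 * r)) (fun y => (σ y ^ 2) ^ d)) ^ (1 / d) with hMdef
  have hM0 : 0 ≤ M := Real.rpow_nonneg (finavg_nonneg_of_nonneg fun y => Real.rpow_nonneg (sq_nonneg (σ y)) d) _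
  have hAη : 0 ≤ A * η := mul_nonneg hA hη.le
  have hr2 : (0 : ℝ) < r ^ 2 := by positivity
  have hb1 : (0 : ℝ) ≤ 9 / 4 * c₁ * CKS := by positivity
  have hb2 : (0 : ℝ) ≤ 324 * CKS / κ := by positivity
  by_cases hnear : finavg (S ∩ ball x (3 / 2 * r)) (fun p => ‖Ψ' p - (U p + v)‖ ^ 2) ≤ κ * r ^ 2
  · -- NEAR-rigid case: the GSC Caccioppoli inequality (ii♭) at `(U, v)`
    have h1 := hii x hx r hr hsub U v hU hnear
    have hdiv : finavg (S ∩ ball x (3 / 2 * r)) (fun p => ‖Ψ' p - (U p + v)‖ ^ 2) / r ^ 2 ≤ CKS * (3 / 2 * r) ^ 2 * M / r ^ 2 :=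
      div_le_div_of_nonneg_right hks' hr2.le
    have hc₁b : c₁ ≤ 9 / 4 * c₁ * CKS := by nlinarith
    calc finavg (S ∩ ball x r) (fun y => σ y ^ 2)
        ≤ c₁ * (finavg (S ∩ ball x (3 / 2 * r)) (fun p => ‖Ψ' p - (U p + v)‖ ^ 2) / r ^ 2 + A * η) := h1
      _ ≤ c₁ * (CKS * (3 / 2 * r) ^ 2 * M / r ^ 2 + A * η) :=
          mul_le_mul_of_nonneg_left (add_le_add hdiv le_rfl) hc₁.le
      _ = 9 / 4 * c₁ * CKS * M + c₁ * (A * η) := by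
          field_simp
          ring
      _ ≤ 9 / 4 * c₁ * CKS * M + 9 / 4 * c₁ * CKS * (A * η) := by
          have := mul_le_mul_of_nonneg_right hc₁b hAη
          linarith
      _ = 9 / 4 * c₁ * CKS * (M + A * η) := by ring
      _ ≤ (9 / 4 * c₁ * CKS + 324 * CKS / κ) * (M + A * η) := by
          have := mul_nonneg hb2 (add_nonneg hM0 hAη)
          nlinarith
  · -- FAR case: the rigidity lower bound on `M` against the pointwise bound `σ ≤ 12`
    have hfar : κ * r ^ 2 < CKS * (3 / 2 * r) ^ 2 * M := lt_of_lt_of_le (not_le.mp hnear) hks'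
    have hκM : κ ≤ 9 / 4 * CKS * M := by
      by_contra hcon
      have hlt : 9 / 4 * CKS * M * r ^ 2 < κ * r ^ 2 := mul_lt_mul_of_pos_right (not_le.mp hcon) hr2
      nlinarith
    have h144 : finavg (S ∩ ball x r) (fun y => σ y ^ 2) ≤ 144 := by
      refine finavg_le_of_le (by norm_num) fun y _ => ?_
      have h0 : 0 ≤ σ y := hd.2.1 y
      nlinarith [h12 y]
    calc finavg (S ∩ ball x r) (fun y => σ y ^ 2) ≤ 144 := h144
      _ ≤ 324 * CKS / κ * M := by
          rw [div_mul_eq_mul_div, le_div_iff₀ hκ]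
          nlinarith
      _ ≤ (9 / 4 * c₁ * CKS + 324 * CKS / κ) * (M + A * η) := by
          have := mul_nonneg hb1 (add_nonneg hM0 hAη)
          have := mul_nonneg hb2 hAη
          nlinarith

/-- ★★★ **COROLLARY (PROVED): the tame line down to [C]** — `[T] ∧ [KS] ∧ [CC] ⇒ [C] RigidCaccioppoliPG`. [this file, g43] -/
theorem rigidCaccioppoliPG_of_tame_line {ϑ aHi Λ θ s : ℝ} (hT : TameWindowPG ϑ aHi Λ θ s) (hKS : KornSobolevPoincareP aHi θ)
    (hCC : TameGscCaccioppoliPG ϑ aHi Λ θ s) : RigidCaccioppoliPG aHi Λ θ s :=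
  rigidCaccioppoliPG_of_tame hT (tameRigidCaccioppoliPG_of_gscCaccioppoli_of_kornSobolev hKS hCC)

/-- ★★★ **COROLLARY (PROVED): the tame line down to (M)** — with the Gehring leaf (part UB): `[T] ∧ [KS] ∧ [CC] ∧ leaf ⇒ StrainNonConcentrationPG`
(`aHi ≤ 8/7`). [this file, g43] -/
theorem strainNonConcentrationPG_of_tame_line {ϑ aHi Λ θ s : ℝ} (haHi : aHi ≤ 8 / 7) (hG : ZatorskaGoldstein2005_localGehringLemmaCounting)
    (hT : TameWindowPG ϑ aHi Λ θ s) (hKS : KornSobolevPoincareP aHi θ) (hCC : TameGscCaccioppoliPG ϑ aHi Λ θ s) :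
    StrainNonConcentrationPG aHi Λ θ s :=
  strainNonConcentrationPG_of_rigidCaccioppoliPG haHi hG (rigidCaccioppoliPG_of_tame_line hT hKS hCC)

/-- Record example (dichotomy) at the line's literals `(aHi; Λ, θ, s; ϑ) = (1; 2, 1/16, 1/50; tameRadius)`. -/
example (hT : TameWindowPG tameRadius 1 2 (1 / 16) (1 / 50)) (hC : TameRigidCaccioppoliPG tameRadius 1 2 (1 / 16) (1 / 50)) :
    RigidCaccioppoliPG 1 2 (1 / 16) (1 / 50) :=
  rigidCaccioppoliPG_of_tame hT hC

/-- Record example (mechanism layer) at the same literals. -/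
example (hT : TameWindowPG tameRadius 1 2 (1 / 16) (1 / 50)) (hKS : KornSobolevPoincareP 1 (1 / 16))
    (hCC : TameGscCaccioppoliPG tameRadius 1 2 (1 / 16) (1 / 50)) : RigidCaccioppoliPG 1 2 (1 / 16) (1 / 50) :=
  rigidCaccioppoliPG_of_tame_line hT hKS hCC

end Summit.AtomisticToContinuum.Crystallization.Theorems.ChartedZeroExcessLayeredLatticeLiouville

end
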